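import Summits.BirchSwinnertonDyer.BirchSwinnertonDyer.Theorems.AlignedTransportAtTwoMainConjectureOfRankZeroBSDAtTwoHalfDescentLayerIndexCertificateLayer
import Summits.BirchSwinnertonDyer.BirchSwinnertonDyer.Theorems.AlignedTransportAtTwoMainConjectureOfRankZeroBSDAtTwoSeed
import HarnessLib

/-!
# Route `AlignedTransportAtTwo`, crux C2 `MainConjectureOfRankZeroBSDAtTwo` (stmt-BirchSwinnertonDyer-22298):
# THE DESCENT NUMBER WITHOUT GREENBERG 4.14, V — THE SEED FED BY THE CERTIFICATE (`p = 2`): PRINT + `BSD(W,2)` + ONE UPPER BOUND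
# `0 < #ker((1 + conj_γ^{2ⁿ}) | Sel_{2^∞}(W/ℚ_∞)) < 2^{2ⁿ}` at ANY ONE layer for every cyclotomic datum ⟹ Mazur's `2`-adic main conjecture for `W`;
# hence the crux statement C2 BY NAME from PRINT + that certificate on the seed cell

HONEST FRAMING (cell `bsd-f1-sign2`, WIDTH-5 attached prover seat `bsd-line-att-p5` gen 55 on line `birth` of the lead `bsd-line-att-p2`;
`--supports` stmt-BirchSwinnertonDyer-22298, closes nothing; BSD is NOT proved by any of this; the crux C2, its verdict «blocked-on
`Rank1Residual.GreenbergMuConjectureIrreducible`» and every registered stub (P / T / Kμ / LimDoor / MuIneqʳ / PFμ⁺) are untouched). THEOREMS ONLY — no `def`,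
no instance, no `sorry`; the PRINT binders are exactly the seed's (`h17` Kato 17.4 (1)(2) at `2`, `hGr` Greenberg 4.1, `hper` period unit, `hmod` modularity,
`hGZK` Gross–Zagier–Kolyvagin), displayed. Sequel of `…HalfDescentLayerIndexCertificateSelmer` (this gen, route-independent: for EVERY dual datum with `X` f.g.
torsion, `0 < #ker(N_n | Sel_∞) < p^{pⁿ(p−1)}` at ANY ONE `n` ⟹ `μ(X) = 0`) and `…HalfDescentLayerIndexCertificateLayer` (the same from
`0 < #Sel_∞^{Γ_{n+1}} < p^{pⁿ(p−1)}`, or from the FINITE-LEVEL count `0 < #Sel_{p^∞}(E/K_{n+1})·#ker g_{n+1} < p^{pⁿ(p−1)}`) composed with the lead's seed `…Seed.mazurMainConjecture_two_of_bsdp_of_mu_eq_zero`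
(p583329: PRINT + `BSD(W,2)` + `μ₂(X) = 0` for every cyclotomic datum ⟹ `MazurMainConjecture W 2`). This file lives in the route's import cone on purpose (it names
the crux); the route-independent mathematics is in files I–IV.

WHAT THIS BUYS FOR C2. g54: MC at the datum ⟺ `#ker N_n = 2^{λ_an}` EXACTLY at the first layer with `2ⁿ > λ_an`, under the binder `hnf`/`prop414` (Greenberg
4.14) and with `λ_an` read off `L₂`. HERE: the `μ`-residue of C2 — the ONLY non-print input of the seed (lead g0–g6: «C2 ⟺ stub T mod PRINT») — follows from
**ONE INEQUALITY `0 < #ker((1 + conj_γ^{2ⁿ}) | Sel_{2^∞}(W/ℚ_∞)) < 2^{2ⁿ}` at ANY ONE layer `n`**, for every cyclotomic `(κ, γ)`: no Greenberg 4.14, no `λ_an`,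
no `G`, no exactness; an upper bound is what a descent produces. It is a CERTIFICATE shape (per curve, like the lead's `TowerGapAtTwo`), not a proof of `μ = 0`.

* ★★★ **`mazurMainConjecture_two_of_bsdp_of_natCard_endInvariants_relNorm_lt`**: PRINT + good ordinary at `2` + no rational `2`-torsion + `r_an = 0` + `BSD(W,2)`
  + (for every cyclotomic `(κ,γ)` some `n` with `0 < #ker N_n < 2^{2ⁿ}`) ⟹ **`MazurMainConjecture W 2`**;
* ★★★ **`mainConjectureOfRankZeroBSDAtTwo_of_natCard_endInvariants_relNorm_lt`**: PRINT + that certificate on every seed-cell curve ⟹ the crux statement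
  `MainConjectureOfRankZeroBSDAtTwo` BY NAME (cf. the lead's `…_of_seedMuZero`, whose non-print input `∀ D, D.mu = 0` is replaced by the displayed inequality).
* §3 FINITE LEVEL: ★★★ **`mazurMainConjecture_two_of_bsdp_of_natCard_selmerLayer_mul_kerG_lt`** / **`mainConjectureOfRankZeroBSDAtTwo_of_natCard_selmerLayer_mul_kerG_lt`**:
  the same with the certificate **`0 < #Sel_{2^∞}(W/ℚ_{n+1}) · #ker g_{n+1} < 2^{2ⁿ}`** at some layer `n` (`ℚ_m = ℚ(ζ_{2^{m+2}})⁺`; `ker g_m` Greenberg's control kernel) —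
  orders of FINITE-LEVEL objects only; and `…_of_natCard_selmerInvariants_lt` with `0 < #Sel_{2^∞}(W/ℚ_∞)^{Γ_{n+1}} < 2^{2ⁿ}`.
Memo `Cruxes/MainConjectureOfRankZeroBSDAtTwo/LAYER-INDEX-FINITE-att-p5-g55.md`. BSD is not proved by any of this; no certificate is computed here for any curve.

References: R. Greenberg, LNM 1716 (1999), §1 pp. 60–65, Conj. 1.11, Thm. 4.1 [GreenbergLNM1716]; K. Kato, Astérisque 295 (2004) Thm. 17.4 [Kato2004Asterisque];
L. Washington, GTM 83, §13.3 Thm. 13.13 [Washington1997]; R. L. Miller, LMS J. Comput. Math. 14 (2011) Def. 1.1 [Miller2011LMS].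
-/

set_option linter.dupNamespace false
set_option autoImplicit false

noncomputable section

open scoped Classical AddSubgroup MatrixGroups ModularForm Polynomial

namespace Summit.BirchSwinnertonDyer.BirchSwinnertonDyer.Theorems.AlignedTransportAtTwoHalfDescentLayerIndexCertificateSeed

open CongruenceSubgroup WeierstrassCurve Literature.NumberTheory.EllipticCurves Literature.NumberTheory.EllipticCurves.IwasawaDual
  Literature.NumberTheory.EllipticCurves.IwasawaAlgebra
  Literature.NumberTheory.EllipticCurves.ModularForms
  Literature.NumberTheory.EllipticCurves.Rank1Residual
  Literature.NumberTheory.EllipticCurves.Rank1Residual.Typed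
  Literature.NumberTheory.EllipticCurves.Greenberg1999
  Summit.BirchSwinnertonDyer.Rank1Residual
  Summit.BirchSwinnertonDyer.Rank1Residual.X1.MuLambda
  Summit.BirchSwinnertonDyer.Rank1Residual.F1Sign2
  Summit.BirchSwinnertonDyer.Rank1Residual.Iwasawa
  Summit.BirchSwinnertonDyer.BirchSwinnertonDyer.Theorems.Rank1ResidualX1Defs
  Summit.BirchSwinnertonDyer.BirchSwinnertonDyer.Theses.AlignedTransportAtTwo
  Summit.BirchSwinnertonDyer.BirchSwinnertonDyer.Theorems.AlignedTransportAtTwoSeed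
  Summit.BirchSwinnertonDyer.BirchSwinnertonDyer.Theorems.AlignedTransportAtTwoHalfDescentLayerIndexCertificateSelmer
  Summit.BirchSwinnertonDyer.BirchSwinnertonDyer.Theorems.AlignedTransportAtTwoHalfDescentLayerIndexCertificateLayer

/-! ## §1 `p = 2`: the seed of line `birth` fed by the certificate -/

section Two

variable (W : WeierstrassCurve ℚ) [W.IsElliptic] [W.IsGloballyMinimal]

/-- ★★★ **MAZUR'S `2`-ADIC MAIN CONJECTURE FROM `BSD(W,2)` AND ONE UPPER BOUND PER CYCLOTOMIC DATUM.** `W/ℚ` elliptic, globally minimal, good ordinary at `2`,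
no rational point of order `2`, `r_an = 0`, `BSD(W,2)`; PRINT: Kato 17.4 (1)(2) at `2` (`h17`), Greenberg 4.1 (`hGr`), the period unit (`hper`), modularity (`hmod`),
GZK (`hGZK`). CERTIFICATE (displayed, per curve): for every cyclotomic `(κ, γ)` there is a layer `n` with
**`0 < #{s ∈ Sel_{2^∞}(W/ℚ_∞) : (1 + conj_γ^{2ⁿ}) s = 0} < 2^{2ⁿ}`**. Then **`MazurMainConjecture W 2`**. The certificate discharges the seed's only non-print
input `μ₂(X) = 0` (§1); the seed (lead, p583329) does the rest. [cite: Kato2004Asterisque, Thm. 17.4 (1)(2) (p. 273)] [cite: GreenbergLNM1716, Thm. 4.1 (p. 102) and Conj. 1.11]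
[cite: Miller2011LMS, Def. 1.1] -/
theorem mazurMainConjecture_two_of_bsdp_of_natCard_endInvariants_relNorm_lt
    (h17 : ∀ [NeZero (W.conductorNorm ℤ)] (f : CuspForm (Gamma0 (W.conductorNorm ℤ)) 2), kato_divisibility_allPrimes W 2 (f := f))
    (hGr : Greenberg1999.thm41_charValue_rankZero_anyPrime)
    (hper : realPeriodRat_eq_unit_mul_plusPeriod_two) (hmod : nonempty_modularParametrizationData)
    (hGZK : rank_eq_analyticRank_of_analyticRank_le_one) (hord : IsOrdinaryAt W 2)
    (ht : ∀ x : ℚ, ¬ HasRationalTwoTorsionX W x) (hr : W.analyticRank = 0) (hbsd : BSDp W 2)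
    (hcert : ∀ (κ : ZpExtension ℚ 2) (γ : Field.absoluteGaloisGroup ℚ), κ.IsCyclotomic → κ.IsTopGenerator γ → IsCyclotomicVariable 2 γ →
      ∃ n : ℕ, 0 < Nat.card ↥(endInvariants (∑ i ∈ Finset.range 2, ((W.conjSelmerInfty κ γ) ^ (2 ^ n)) ^ i)) ∧
        Nat.card ↥(endInvariants (∑ i ∈ Finset.range 2, ((W.conjSelmerInfty κ γ) ^ (2 ^ n)) ^ i)) < 2 ^ (2 ^ n)) :
    MazurMainConjecture W 2 := by
  refine AlignedTransportAtTwoSeed.mazurMainConjecture_two_of_bsdp_of_mu_eq_zero W h17 hGr hper hmod hGZK hord ht hr hbsd ?_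
  intro κ γ hκ hγ hγ' D hD
  haveI : Module.Finite (IwasawaAlgebra 2) D.X := D.module_finite_holds hγ
  obtain ⟨n, hpos, hlt⟩ := hcert κ γ hκ hγ hγ'
  have hlt' : Nat.card ↥(endInvariants (∑ i ∈ Finset.range 2, ((W.conjSelmerInfty κ γ) ^ (2 ^ n)) ^ i)) < 2 ^ (2 ^ n * (2 - 1)) := by
    rw [show (2:ℕ) - 1 = 1 from rfl, mul_one]; exact hlt
  exact (mu_eq_zero_of_natCard_endInvariants_relNorm_pos_lt W κ hγ D hD hpos hlt').1

end Two

/-! ## §2 The crux by name from PRINT + the certificate on the seed cell -/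

section Crux

/-- ★★★ **C2 FROM PRINT + ONE UPPER BOUND PER SEED CURVE.** PRINT (`h17` for every curve, `hGr`, `hper`, `hmod`, `hGZK`) and, for every seed-cell curve `W`
(elliptic, globally minimal, non-CM, good ordinary at `2`, no rational `2`-torsion, `Δ ∉ ℚ²`, `r_an = 0`) and every cyclotomic `(κ, γ)`, SOME layer `n` with
**`0 < #ker((1 + conj_γ^{2ⁿ}) | Sel_{2^∞}(W/ℚ_∞)) < 2^{2ⁿ}`** ⟹ the crux statement **`MainConjectureOfRankZeroBSDAtTwo`** by name. Compared with the lead's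
`…Seed.mainConjectureOfRankZeroBSDAtTwo_of_seedMuZero` the non-print input «`∀ D, D.mu = 0`» is replaced by a displayed, per-curve-checkable inequality; the
analytic `μ₂ = 0` hypothesis and `BSD(W,2)` of C2 are consumed by the seed. CONDITIONAL result: the item stays open (the certificate is not computed here).
[cite: Kato2004Asterisque, Thm. 17.4 (1)(2) (p. 273)] [cite: GreenbergLNM1716, Thm. 4.1 (p. 102), §1 Conj. 1.11 (p. 58)] -/
theorem mainConjectureOfRankZeroBSDAtTwo_of_natCard_endInvariants_relNorm_lt
    (h17 : ∀ (V : WeierstrassCurve ℚ) [V.IsElliptic] [V.IsGloballyMinimal] [NeZero (V.conductorNorm ℤ)]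
      (f : CuspForm (Gamma0 (V.conductorNorm ℤ)) 2), kato_divisibility_allPrimes V 2 (f := f))
    (hGr : Greenberg1999.thm41_charValue_rankZero_anyPrime)
    (hper : realPeriodRat_eq_unit_mul_plusPeriod_two) (hmod : nonempty_modularParametrizationData)
    (hGZK : rank_eq_analyticRank_of_analyticRank_le_one)
    (hcert : ∀ (W : WeierstrassCurve ℚ) [W.IsElliptic] [W.IsGloballyMinimal], ¬ W.HasCM →
      IsOrdinaryAt W 2 → (∀ x : ℚ, ¬ HasRationalTwoTorsionX W x) → ¬ IsSquare W.Δ → W.analyticRank = 0 →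
      ∀ (κ : ZpExtension ℚ 2) (γ : Field.absoluteGaloisGroup ℚ), κ.IsCyclotomic → κ.IsTopGenerator γ → IsCyclotomicVariable 2 γ →
        ∃ n : ℕ, 0 < Nat.card ↥(endInvariants (∑ i ∈ Finset.range 2, ((W.conjSelmerInfty κ γ) ^ (2 ^ n)) ^ i)) ∧
          Nat.card ↥(endInvariants (∑ i ∈ Finset.range 2, ((W.conjSelmerInfty κ γ) ^ (2 ^ n)) ^ i)) < 2 ^ (2 ^ n)) :
    MainConjectureOfRankZeroBSDAtTwo := by
  intro W _ _ hcm hord ht hsq hr _hμan hbsd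
  exact mazurMainConjecture_two_of_bsdp_of_natCard_endInvariants_relNorm_lt W (fun f => h17 W f) hGr hper hmod hGZK hord ht hr hbsd
    (hcert W hcm hord ht hsq hr)

end Crux

/-! ## §3 Finite level: `0 < #Sel_{2^∞}(W/ℚ_{n+1}) · #ker g_{n+1} < 2^{2ⁿ}` at one layer -/

section Finite

variable (W : WeierstrassCurve ℚ) [W.IsElliptic] [W.IsGloballyMinimal]

/-- ★★★ **MAZUR'S `2`-ADIC MAIN CONJECTURE FROM `BSD(W,2)` AND FEW `Γ_{n+1}`-INVARIANTS AT ONE LAYER.** As `mazurMainConjecture_two_of_bsdp_of_natCard_endInvariants_relNorm_lt`,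
with the certificate **`0 < #Sel_{2^∞}(W/ℚ_∞)^{Γ_{n+1}} < 2^{2ⁿ}`** for some `n`, for every cyclotomic `(κ, γ)`.
[cite: Kato2004Asterisque, Thm. 17.4 (1)(2) (p. 273)] [cite: GreenbergLNM1716, Thm. 4.1 (p. 102), Conj. 1.11, §1 pp. 60–65] [cite: Miller2011LMS, Def. 1.1] -/
theorem mazurMainConjecture_two_of_bsdp_of_natCard_selmerInvariants_lt
    (h17 : ∀ [NeZero (W.conductorNorm ℤ)] (f : CuspForm (Gamma0 (W.conductorNorm ℤ)) 2), kato_divisibility_allPrimes W 2 (f := f))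
    (hGr : Greenberg1999.thm41_charValue_rankZero_anyPrime)
    (hper : realPeriodRat_eq_unit_mul_plusPeriod_two) (hmod : nonempty_modularParametrizationData)
    (hGZK : rank_eq_analyticRank_of_analyticRank_le_one) (hord : IsOrdinaryAt W 2)
    (ht : ∀ x : ℚ, ¬ HasRationalTwoTorsionX W x) (hr : W.analyticRank = 0) (hbsd : BSDp W 2)
    (hcert : ∀ (κ : ZpExtension ℚ 2) (γ : Field.absoluteGaloisGroup ℚ), κ.IsCyclotomic → κ.IsTopGenerator γ → IsCyclotomicVariable 2 γ →
      ∃ n : ℕ, 0 < Nat.card ↥(W.selmerInfty κ ⊓ W.layerInvariants κ (n + 1)) ∧ Nat.card ↥(W.selmerInfty κ ⊓ W.layerInvariants κ (n + 1)) < 2 ^ (2 ^ n)) :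
    MazurMainConjecture W 2 := by
  refine AlignedTransportAtTwoSeed.mazurMainConjecture_two_of_bsdp_of_mu_eq_zero W h17 hGr hper hmod hGZK hord ht hr hbsd ?_
  intro κ γ hκ hγ hγ' D hD
  haveI : Module.Finite (IwasawaAlgebra 2) D.X := D.module_finite_holds hγ
  obtain ⟨n, hpos, hlt⟩ := hcert κ γ hκ hγ hγ'
  have hlt' : Nat.card ↥(W.selmerInfty κ ⊓ W.layerInvariants κ (n + 1)) < 2 ^ (2 ^ n * (2 - 1)) := by
    rw [show (2:ℕ) - 1 = 1 from rfl, mul_one]; exact hlt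
  exact mu_eq_zero_of_natCard_selmerInvariants_pos_lt W κ hγ D hD hpos hlt'

/-- ★★★ **MAZUR'S `2`-ADIC MAIN CONJECTURE FROM `BSD(W,2)` AND FINITE-LEVEL ORDERS.** `W/ℚ` elliptic, globally minimal, good ordinary at `2`, no rational `2`-torsion,
`r_an = 0`, `BSD(W,2)`; PRINT as in the seed. CERTIFICATE: for every cyclotomic `(κ, γ)` some layer `n` with
**`0 < #Sel_{2^∞}(W/ℚ_{n+1}) · #ker g_{n+1} < 2^{2ⁿ}`** (`ℚ_m = ℚ(ζ_{2^{m+2}})⁺`, `ker g_m = A_m/Sel_m` Greenberg's control kernel). Then **`MazurMainConjecture W 2`**.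
[cite: Kato2004Asterisque, Thm. 17.4 (1)(2) (p. 273)] [cite: GreenbergLNM1716, Thm. 4.1 (p. 102), §4 Lemma 4.3 (p. 103), Conj. 1.11] [cite: Miller2011LMS, Def. 1.1] -/
theorem mazurMainConjecture_two_of_bsdp_of_natCard_selmerLayer_mul_kerG_lt
    (h17 : ∀ [NeZero (W.conductorNorm ℤ)] (f : CuspForm (Gamma0 (W.conductorNorm ℤ)) 2), kato_divisibility_allPrimes W 2 (f := f))
    (hGr : Greenberg1999.thm41_charValue_rankZero_anyPrime)
    (hper : realPeriodRat_eq_unit_mul_plusPeriod_two) (hmod : nonempty_modularParametrizationData)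
    (hGZK : rank_eq_analyticRank_of_analyticRank_le_one) (hord : IsOrdinaryAt W 2)
    (ht : ∀ x : ℚ, ¬ HasRationalTwoTorsionX W x) (hr : W.analyticRank = 0) (hbsd : BSDp W 2)
    (hcert : ∀ (κ : ZpExtension ℚ 2) (γ : Field.absoluteGaloisGroup ℚ), κ.IsCyclotomic → κ.IsTopGenerator γ → IsCyclotomicVariable 2 γ →
      ∃ n : ℕ, 0 < Nat.card ↥(W.selmerLayer κ (n + 1)) * Nat.card (W.KerG κ (n + 1)) ∧
        Nat.card ↥(W.selmerLayer κ (n + 1)) * Nat.card (W.KerG κ (n + 1)) < 2 ^ (2 ^ n)) :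
    MazurMainConjecture W 2 := by
  refine AlignedTransportAtTwoSeed.mazurMainConjecture_two_of_bsdp_of_mu_eq_zero W h17 hGr hper hmod hGZK hord ht hr hbsd ?_
  intro κ γ hκ hγ hγ' D hD
  haveI : Module.Finite (IwasawaAlgebra 2) D.X := D.module_finite_holds hγ
  obtain ⟨n, hpos, hlt⟩ := hcert κ γ hκ hγ hγ'
  have hlt' : Nat.card ↥(W.selmerLayer κ (n + 1)) * Nat.card (W.KerG κ (n + 1)) < 2 ^ (2 ^ n * (2 - 1)) := by
    rw [show (2:ℕ) - 1 = 1 from rfl, mul_one]; exact hlt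
  exact mu_eq_zero_of_natCard_selmerLayer_mul_kerG_pos_lt W κ hγ D hD hpos hlt'

/-- ★★★ **C2 BY NAME FROM PRINT + THE FINITE-LEVEL CERTIFICATE ON THE SEED CELL**: PRINT and, for every seed-cell curve and every cyclotomic `(κ, γ)`, some `n` with
`0 < #Sel_{2^∞}(W/ℚ_{n+1}) · #ker g_{n+1} < 2^{2ⁿ}` ⟹ `MainConjectureOfRankZeroBSDAtTwo`. CONDITIONAL (credits nothing; the certificate is not computed here).
[cite: Kato2004Asterisque, Thm. 17.4 (1)(2) (p. 273)] [cite: GreenbergLNM1716, Thm. 4.1 (p. 102), §4 Lemma 4.3 (p. 103), §1 Conj. 1.11 (p. 58)] -/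
theorem mainConjectureOfRankZeroBSDAtTwo_of_natCard_selmerLayer_mul_kerG_lt
    (h17 : ∀ (V : WeierstrassCurve ℚ) [V.IsElliptic] [V.IsGloballyMinimal] [NeZero (V.conductorNorm ℤ)]
      (f : CuspForm (Gamma0 (V.conductorNorm ℤ)) 2), kato_divisibility_allPrimes V 2 (f := f))
    (hGr : Greenberg1999.thm41_charValue_rankZero_anyPrime)
    (hper : realPeriodRat_eq_unit_mul_plusPeriod_two) (hmod : nonempty_modularParametrizationData)
    (hGZK : rank_eq_analyticRank_of_analyticRank_le_one)
    (hcert : ∀ (W : WeierstrassCurve ℚ) [W.IsElliptic] [W.IsGloballyMinimal], ¬ W.HasCM →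
      IsOrdinaryAt W 2 → (∀ x : ℚ, ¬ HasRationalTwoTorsionX W x) → ¬ IsSquare W.Δ → W.analyticRank = 0 →
      ∀ (κ : ZpExtension ℚ 2) (γ : Field.absoluteGaloisGroup ℚ), κ.IsCyclotomic → κ.IsTopGenerator γ → IsCyclotomicVariable 2 γ →
        ∃ n : ℕ, 0 < Nat.card ↥(W.selmerLayer κ (n + 1)) * Nat.card (W.KerG κ (n + 1)) ∧
          Nat.card ↥(W.selmerLayer κ (n + 1)) * Nat.card (W.KerG κ (n + 1)) < 2 ^ (2 ^ n)) :
    MainConjectureOfRankZeroBSDAtTwo := by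
  intro W _ _ hcm hord ht hsq hr _hμan hbsd
  exact mazurMainConjecture_two_of_bsdp_of_natCard_selmerLayer_mul_kerG_lt W (fun f => h17 W f) hGr hper hmod hGZK hord ht hr hbsd
    (hcert W hcm hord ht hsq hr)

end Finite

end Summit.BirchSwinnertonDyer.BirchSwinnertonDyer.Theorems.AlignedTransportAtTwoHalfDescentLayerIndexCertificateSeed

end
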